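import Literature.MathematicalPhysics.KineticTheory.InfiniteChainGibbsExistence
import Literature.Probability.LatticeModels.TransferIterateMarginal
import HarnessLib

/-!
# Finite-volume Gibbs integrals of the chain on an interval, in transfer-operator form

Topic `Literature/MathematicalPhysics/KineticTheory`; theorems only (no definitions, no named
facts). Companion of `InfiniteChainSpecificationDensity.lean` (the kernels
`γ_Λ(· | η)` of `OscillatorChain.chainSpecification P T` as ratios of marginal integrals
`(∫⋯∫⁻_Λ F e^{-H_Λ/T}) / (∫⋯∫⁻_Λ e^{-H_Λ/T})`), `InfiniteChainGibbsExistence.lean` (factorisation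
`e^{-H_Λ/T} = ∏ w(σ_x) ∏ k(σ_y, σ_{y+1})` into the one-site weight
`w = e^{-(p²/2+U(q))/T}` and the bond kernel `k(z,z') = e^{-V(q'-q)/T}`) and
`Literature.Probability.LatticeModels.TransferIterateMarginal` (block marginal integrals are
iterates of the transfer map `(T f)(z) = ∫ k(z,y) w(y) f(y) dy`).

For an observable `F` reading only the window `{c, …, d}` (`c < d`) and the interval
`Λ_n = {c-n, …, d+n}` with boundary spins `u = η_{c-n-1}`, `v = η_{d+n+1}`, the numerator of
`γ_{Λ_n}(F | η)` is

  `(∫⋯∫⁻_{Λ_n} F e^{-H/T})(η) = (T^{n+1} M_F T^{n} k_v)(u)`,     `k_v = k(·, v)`,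

where `M_F` is the "window operator" `(M_F ψ)(x) = ∫⋯∫⁻_{c<y≤d} F · ∏_{c<y≤d} w(σ_y)k(σ_{y-1},σ_y) · ψ(σ_d)`
at `σ_c = x` (Georgii 2011, Ch. 10–11: transfer-matrix form of one-dimensional specifications;
Cassandro–Olivieri–Pellegrinotti–Presutti 1978, §2–3, for this chain). This is the input of the
boundary-independence (uniqueness) argument via the spectral gap of the transfer operator. As in
the neighbouring files, `k`, `w`, the transfer map `Tr` and the window operator `TM` are VARIABLES
constrained by hypotheses (`hw`, `hk`, `hTr`, `hTM`), so no definition is introduced.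

* `bondSet_Icc`, `prod_Icc_sub_one_shift`, `boltzmann_Icc_eq_blockWeight` — interval bookkeeping
  and `e^{-H_{[a,b]}/T} = [∏_{a≤y≤b} w(σ_y) k(σ_{y-1},σ_y)] · k(σ_b, σ_{b+1})`;
* `lmarginal_Icc_boltzmann_eq_iterate` (**main**) — the displayed identity;
* `windowOp_eq_lintegral_kernel` — `(M_F ψ)(x) = ∫ m_F(x,y) w(y) ψ(y) dy` with the window kernel
  `m_F(x,y) = ∫⋯∫⁻_{c<y'<d} F ∏ w k · k(σ_{d-1}, y)` at `σ_c = x`, `σ_d = y`;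
* `measurable_windowKernel`, `windowKernel_le`, `windowKernel_pos` — the window kernel is jointly
  measurable, bounded by `(∫ w)^{d-c-1}` when `F ≤ 1`, and everywhere positive when `F = 1`.

[cite: Georgii2011, Thm 10.25 and §11.1]
-/

noncomputable section

open MeasureTheory Set Function Finset Literature.Probability.LatticeModels
open scoped ENNReal

namespace Literature.MathematicalPhysics.KineticTheory.HeatConduction

namespace OscillatorChain

variable (P : OscillatorChain)

/-! ### Interval bookkeeping -/

omit P in
/-- The bonds meeting the interval `{a, …, b}` (`a ≤ b`), indexed by their left endpoint, are
`{a-1, …, b}`. [folklore] -/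
theorem bondSet_Icc {a b : ℤ} (hab : a ≤ b) : bondSet (Finset.Icc a b) = Finset.Icc (a - 1) b := by
  ext y
  rw [mem_bondSet_iff]
  simp only [Finset.mem_Icc]
  omega

omit P in
/-- Re-indexing the bonds of an interval by their right endpoint. [folklore] -/
theorem prod_Icc_sub_one_shift {M : Type*} [CommMonoid M] (f : ℤ → ℤ → M) (a b : ℤ) :
    ∏ y ∈ Finset.Icc (a - 1) b, f y (y + 1) = ∏ y ∈ Finset.Icc a (b + 1), f (y - 1) y := by
  refine Finset.prod_nbij' (fun y => y + 1) (fun y => y - 1) ?_ ?_ ?_ ?_ ?_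
  · intro y hy; simp only [Finset.mem_Icc] at hy ⊢; omega
  · intro y hy; simp only [Finset.mem_Icc] at hy ⊢; omega
  · intro y _; ring
  · intro y _; ring
  · intro y _; simp

section Transfer

variable {T : ℝ} {k : ℝ × ℝ → ℝ × ℝ → ℝ≥0∞} {w : ℝ × ℝ → ℝ≥0∞}

/-- **The Boltzmann weight of an interval as a block weight**: for `a ≤ b`,
`e^{-H_{[a,b]}(σ)/T} = [∏_{a ≤ y ≤ b} w(σ_y) k(σ_{y-1}, σ_y)] · k(σ_b, σ_{b+1})` with the one-site
weight `w = e^{-(p²/2+U)/T}` and the bond kernel `k(z,z') = e^{-V(q'-q)/T}`.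
[cite: Georgii2011, Thm 10.25 and §11.1] -/
theorem boltzmann_Icc_eq_blockWeight
    (hw : ∀ z, w z = ENNReal.ofReal (Real.exp (-T⁻¹ * (z.2 ^ 2 / 2 + P.U z.1))))
    (hk : ∀ z z', k z z' = ENNReal.ofReal (Real.exp (-T⁻¹ * P.V (z'.1 - z.1))))
    {a b : ℤ} (hab : a ≤ b) (σ : ChainConfig) :
    ENNReal.ofReal (Real.exp (-T⁻¹ * hamiltonianIn P.chainPotential chainSupp (Finset.Icc a b) σ)) =
      (∏ y ∈ Finset.Icc a b, (w (σ y) * k (σ (y - 1)) (σ y))) * k (σ b) (σ (b + 1)) := by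
  rw [P.ofReal_exp_neg_hamiltonianIn, bondSet_Icc hab,
    prod_Icc_sub_one_shift (fun y y' => ENNReal.ofReal (Real.exp (-T⁻¹ * P.V ((σ y').1 - (σ y).1)))) a b]
  have hsplit : Finset.Icc a (b + 1) = insert (b + 1) (Finset.Icc a b) := by
    ext y; simp only [Finset.mem_Icc, Finset.mem_insert]; omega
  have hnot : b + 1 ∉ Finset.Icc a b := by simp
  rw [hsplit, Finset.prod_insert hnot, Finset.prod_mul_distrib]
  simp only [hw, hk, add_sub_cancel_right]
  ring

/-- Measurability of the block weight of an interval. [folklore] -/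
theorem measurable_blockWeight (hkm : Measurable (uncurry k)) (hwm : Measurable w) (s : Finset ℤ) :
    Measurable fun σ : ChainConfig => ∏ y ∈ s, (w (σ y) * k (σ (y - 1)) (σ y)) :=
  Finset.measurable_prod _ fun y _ => (measurable_comp_eval hwm y).mul (measurable_kernel_eval hkm _ _)

omit P in
/-- The block weight of `s` reads only the sites of `s` and their left neighbours. [folklore] -/
theorem dependsOn_blockWeight (s : Finset ℤ) {t : Set ℤ} (ht : ∀ y ∈ s, y ∈ t ∧ y - 1 ∈ t) :
    DependsOn (fun σ : ChainConfig => ∏ y ∈ s, (w (σ y) * k (σ (y - 1)) (σ y))) t := by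
  intro σ σ' hσ
  refine Finset.prod_congr rfl fun y hy => ?_
  rw [hσ y (ht y hy).1, hσ (y - 1) (ht y hy).2]

/-- **Interval Gibbs integrals in transfer-operator form.** Let `F ≥ 0` be measurable and read only
the window `{c, …, d}`, `c < d`, and let `n : ℕ`. With the transfer map
`(T f)(z) = ∫ k(z,y) w(y) f(y) dy` and the window operator
`(M_F ψ)(x) = (∫⋯∫⁻_{c<y≤d} F · ∏_{c<y≤d} w(σ_y) k(σ_{y-1},σ_y) · ψ(σ_d))(σ_c := x)` (reference
configuration `η₀` arbitrary), the un-normalised Gibbs integral of `F` over the interval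
`{c-n, …, d+n}` with boundary condition `η` is
`(∫⋯∫⁻ F e^{-H/T})(η) = (T^{n+1} (M_F (T^{n} k(·, η_{d+n+1}))))(η_{c-n-1})`.
[cite: Georgii2011, Thm 10.25 and §11.1] -/
theorem lmarginal_Icc_boltzmann_eq_iterate
    (hw : ∀ z, w z = ENNReal.ofReal (Real.exp (-T⁻¹ * (z.2 ^ 2 / 2 + P.U z.1))))
    (hk : ∀ z z', k z z' = ENNReal.ofReal (Real.exp (-T⁻¹ * P.V (z'.1 - z.1))))
    (hkm : Measurable (uncurry k)) (hwm : Measurable w)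
    {Tr : (ℝ × ℝ → ℝ≥0∞) → (ℝ × ℝ → ℝ≥0∞)}
    (hTr : ∀ f z, Tr f z = ∫⁻ y, k z y * w y * f y)
    {c d : ℤ} (hcd : c < d) {F : ChainConfig → ℝ≥0∞} (hFm : Measurable F)
    (hFd : DependsOn F (↑(Finset.Icc c d) : Set ℤ)) (η₀ : ChainConfig)
    {TM : (ℝ × ℝ → ℝ≥0∞) → (ℝ × ℝ → ℝ≥0∞)}
    (hTM : ∀ ψ x, TM ψ x = (∫⋯∫⁻_Finset.Icc (c + 1) d, (fun σ => F σ *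
        (∏ y ∈ Finset.Icc (c + 1) d, (w (σ y) * k (σ (y - 1)) (σ y))) * ψ (σ d))
          ∂fun _ : ℤ => (volume : Measure (ℝ × ℝ))) (Function.update η₀ c x))
    (n : ℕ) (η : ChainConfig) :
    (∫⋯∫⁻_Finset.Icc (c - n) (d + n), (fun σ => F σ *
        ENNReal.ofReal (Real.exp (-T⁻¹ *
          hamiltonianIn P.chainPotential chainSupp (Finset.Icc (c - n) (d + n)) σ)))
      ∂fun _ : ℤ => (volume : Measure (ℝ × ℝ))) η =
      (Tr^[n + 1] (TM (Tr^[n] fun z => k z (η (d + n + 1))))) (η (c - n - 1)) := by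
  -- notation: blocks, block weights, boundary spin on the right
  set L' : Finset ℤ := Finset.Icc (c - n) c with hL'
  set M' : Finset ℤ := Finset.Icc (c + 1) (d + n) with hM'
  set W' : Finset ℤ := Finset.Icc (c + 1) d with hW'
  set R' : Finset ℤ := Finset.Icc (d + 1) (d + n) with hR'
  set v : ℝ × ℝ := η (d + n + 1) with hv
  have hΛ : Finset.Icc (c - n) (d + n) = L' ∪ M' := by
    ext x; simp only [hL', hM', Finset.mem_Icc, Finset.mem_union]; omega
  have hLM : Disjoint L' M' := by
    rw [Finset.disjoint_left]; intro x hx hx'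
    simp only [hL', hM', Finset.mem_Icc] at hx hx'; omega
  have hMWR : M' = W' ∪ R' := by
    ext x; simp only [hM', hW', hR', Finset.mem_Icc, Finset.mem_union]; omega
  have hWR : Disjoint W' R' := by
    rw [Finset.disjoint_left]; intro x hx hx'
    simp only [hW', hR', Finset.mem_Icc] at hx hx'; omega
  have hLWR : Finset.Icc (c - n) (d + n) = L' ∪ W' ∪ R' := by rw [hΛ, hMWR, Finset.union_assoc]
  have hLW : Disjoint L' W' := by
    rw [Finset.disjoint_left]; intro x hx hx'
    simp only [hL', hW', Finset.mem_Icc] at hx hx'; omega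
  have hLWuR : Disjoint (L' ∪ W') R' := by
    rw [Finset.disjoint_union_left]
    refine ⟨?_, hWR⟩
    rw [Finset.disjoint_left]; intro x hx hx'
    simp only [hL', hR', Finset.mem_Icc] at hx hx'; omega
  -- measurability of the pieces
  have hWB : ∀ s : Finset ℤ, Measurable fun σ : ChainConfig =>
      ∏ y ∈ s, (w (σ y) * k (σ (y - 1)) (σ y)) := fun s => measurable_blockWeight hkm hwm s
  have hkv : Measurable fun z => k z v := hkm.comp (measurable_id.prodMk measurable_const)
  have hkσ : ∀ i : ℤ, Measurable fun σ : ChainConfig => k (σ i) v := fun i =>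
    hkv.comp (measurable_pi_apply i)
  -- Step 0: the integrand on the `Λ`-fibre of `η`
  have hnotin : d + n + 1 ∉ Finset.Icc (c - n) (d + n) := by simp
  have hprodsplit : ∀ σ : ChainConfig, ∏ y ∈ Finset.Icc (c - n) (d + n), (w (σ y) * k (σ (y - 1)) (σ y)) =
      (∏ y ∈ L', (w (σ y) * k (σ (y - 1)) (σ y))) * (∏ y ∈ W', (w (σ y) * k (σ (y - 1)) (σ y))) *
        ∏ y ∈ R', (w (σ y) * k (σ (y - 1)) (σ y)) := by
    intro σ
    rw [hLWR, Finset.prod_union hLWuR, Finset.prod_union hLW]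
  have hfib : ∀ ζ : ↥(Finset.Icc (c - n) (d + n)) → ℝ × ℝ,
      (fun σ : ChainConfig => F σ * ENNReal.ofReal (Real.exp (-T⁻¹ *
        hamiltonianIn P.chainPotential chainSupp (Finset.Icc (c - n) (d + n)) σ)))
        (updateFinset η (Finset.Icc (c - n) (d + n)) ζ) =
      (fun σ : ChainConfig => (∏ y ∈ L', (w (σ y) * k (σ (y - 1)) (σ y))) *
        ((F σ * ∏ y ∈ W', (w (σ y) * k (σ (y - 1)) (σ y))) *
          ((∏ y ∈ R', (w (σ y) * k (σ (y - 1)) (σ y))) * k (σ (d + n)) v)))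
        (updateFinset η (Finset.Icc (c - n) (d + n)) ζ) := by
    intro ζ
    have hlast : updateFinset η (Finset.Icc (c - n) (d + n)) ζ (d + n + 1) = v := by
      simp [updateFinset, hnotin, hv]
    simp only []
    rw [P.boltzmann_Icc_eq_blockWeight hw hk (by omega), hlast, hprodsplit]
    ring
  have hstep0 : (∫⋯∫⁻_Finset.Icc (c - n) (d + n), (fun σ => F σ *
        ENNReal.ofReal (Real.exp (-T⁻¹ *
          hamiltonianIn P.chainPotential chainSupp (Finset.Icc (c - n) (d + n)) σ)))
      ∂fun _ : ℤ => (volume : Measure (ℝ × ℝ))) η =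
      (∫⋯∫⁻_Finset.Icc (c - n) (d + n), (fun σ : ChainConfig =>
        (∏ y ∈ L', (w (σ y) * k (σ (y - 1)) (σ y))) *
        ((F σ * ∏ y ∈ W', (w (σ y) * k (σ (y - 1)) (σ y))) *
          ((∏ y ∈ R', (w (σ y) * k (σ (y - 1)) (σ y))) * k (σ (d + n)) v)))
      ∂fun _ : ℤ => (volume : Measure (ℝ × ℝ))) η := by
    unfold lmarginal
    exact lintegral_congr fun ζ => hfib ζ
  rw [hstep0]
  -- the inner integrand on `M' = W' ∪ R'` and its marginal `Ψ`
  have hinnerm : Measurable fun σ : ChainConfig =>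
      (F σ * ∏ y ∈ W', (w (σ y) * k (σ (y - 1)) (σ y))) *
        ((∏ y ∈ R', (w (σ y) * k (σ (y - 1)) (σ y))) * k (σ (d + n)) v) :=
    (hFm.mul (hWB W')).mul ((hWB R').mul (hkσ _))
  -- Step 1: split `Λ = L' ∪ M'` and pull the `L'`-weight out of the inner marginal
  have hdepL : DependsOn (fun σ : ChainConfig => ∏ y ∈ L', (w (σ y) * k (σ (y - 1)) (σ y)))
      (↑(Finset.Icc (c - n - 1) c) : Set ℤ) :=
    dependsOn_blockWeight L' fun y hy => by
      simp only [hL', Finset.mem_Icc, Finset.coe_Icc, Set.mem_Icc] at hy ⊢; omega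
  have hdisjLM : Disjoint M' (Finset.Icc (c - n - 1) c) := by
    rw [Finset.disjoint_left]; intro x hx hx'
    simp only [hM', Finset.mem_Icc] at hx hx'; omega
  have hprodm : Measurable fun σ : ChainConfig =>
      (∏ y ∈ L', (w (σ y) * k (σ (y - 1)) (σ y))) *
        ((F σ * ∏ y ∈ W', (w (σ y) * k (σ (y - 1)) (σ y))) *
          ((∏ y ∈ R', (w (σ y) * k (σ (y - 1)) (σ y))) * k (σ (d + n)) v)) :=
    (hWB L').mul hinnerm
  rw [hΛ, lmarginal_union _ _ hprodm hLM]
  have hpull : (∫⋯∫⁻_M', (fun σ : ChainConfig =>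
        (∏ y ∈ L', (w (σ y) * k (σ (y - 1)) (σ y))) *
        ((F σ * ∏ y ∈ W', (w (σ y) * k (σ (y - 1)) (σ y))) *
          ((∏ y ∈ R', (w (σ y) * k (σ (y - 1)) (σ y))) * k (σ (d + n)) v)))
      ∂fun _ : ℤ => (volume : Measure (ℝ × ℝ))) =
      fun σ => (∏ y ∈ L', (w (σ y) * k (σ (y - 1)) (σ y))) *
        (∫⋯∫⁻_M', (fun σ : ChainConfig =>
          (F σ * ∏ y ∈ W', (w (σ y) * k (σ (y - 1)) (σ y))) *
            ((∏ y ∈ R', (w (σ y) * k (σ (y - 1)) (σ y))) * k (σ (d + n)) v))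
        ∂fun _ : ℤ => (volume : Measure (ℝ × ℝ))) σ :=
    funext fun σ => lmarginal_mul_left_of_dependsOn' hdepL hdisjLM hinnerm σ
  rw [hpull]
  -- Step 2: the inner marginal over `R'` is `T^[n] k_v` at `σ_d`
  have hRico : R' = Finset.Ico (d + 1) (d + 1 + n) := by
    ext x; simp only [hR', Finset.mem_Icc, Finset.mem_Ico]; omega
  have hRblock : ∀ σ : ChainConfig, (∫⋯∫⁻_R', (fun σ : ChainConfig =>
      (∏ y ∈ R', (w (σ y) * k (σ (y - 1)) (σ y))) * k (σ (d + n)) v)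
        ∂fun _ : ℤ => (volume : Measure (ℝ × ℝ))) σ = (Tr^[n] fun z => k z v) (σ d) := by
    intro σ
    have hfun : (fun σ : ChainConfig => (∏ y ∈ R', (w (σ y) * k (σ (y - 1)) (σ y))) * k (σ (d + n)) v) =
        fun σ => (∏ y ∈ Finset.Ico (d + 1) (d + 1 + n), (w (σ y) * k (σ (y - 1)) (σ y))) *
          (fun z => k z v) (σ (d + 1 + n - 1)) * (fun _ : ChainConfig => (1 : ℝ≥0∞)) σ := by
      funext σ
      rw [hRico, show d + 1 + (n : ℤ) - 1 = d + n by ring, mul_one]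
    rw [hfun, hRico, lmarginal_Ico_blockWeight_eq_iterate_transfer hkm hwm hTr hkv n (d + 1)
      measurable_const (fun _ _ _ => rfl) σ, mul_one, show d + 1 - 1 = d by ring]
  have hdepW : DependsOn (fun σ : ChainConfig => ∏ y ∈ W', (w (σ y) * k (σ (y - 1)) (σ y)))
      (↑(Finset.Icc c d) : Set ℤ) :=
    dependsOn_blockWeight W' (fun y hy => by
      simp only [hW', Finset.mem_Icc, Finset.coe_Icc, Set.mem_Icc] at hy ⊢; omega)
  have hdepFW : DependsOn (fun σ : ChainConfig => F σ * ∏ y ∈ W', (w (σ y) * k (σ (y - 1)) (σ y)))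
      (↑(Finset.Icc c d) : Set ℤ) := by
    intro σ σ' hσ
    have h1 : F σ = F σ' := hFd hσ
    have h2 := hdepW hσ
    dsimp only at h2 ⊢
    rw [h1, h2]
  have hdisjRW : Disjoint R' (Finset.Icc c d) := by
    rw [Finset.disjoint_left]; intro x hx hx'
    simp only [hR', Finset.mem_Icc] at hx hx'; omega
  have hΨ : (∫⋯∫⁻_M', (fun σ : ChainConfig =>
        (F σ * ∏ y ∈ W', (w (σ y) * k (σ (y - 1)) (σ y))) *
          ((∏ y ∈ R', (w (σ y) * k (σ (y - 1)) (σ y))) * k (σ (d + n)) v))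
      ∂fun _ : ℤ => (volume : Measure (ℝ × ℝ))) =
      (∫⋯∫⁻_W', (fun σ : ChainConfig =>
        (F σ * ∏ y ∈ W', (w (σ y) * k (σ (y - 1)) (σ y))) * (Tr^[n] fun z => k z v) (σ d))
      ∂fun _ : ℤ => (volume : Measure (ℝ × ℝ))) := by
    have hRm : Measurable fun σ : ChainConfig =>
        (∏ y ∈ R', (w (σ y) * k (σ (y - 1)) (σ y))) * k (σ (d + n)) v := (hWB R').mul (hkσ _)
    rw [hMWR, lmarginal_union _ _ hinnerm hWR]
    congr 1
    funext σ
    rw [lmarginal_mul_left_of_dependsOn' hdepFW hdisjRW hRm σ, hRblock σ]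
  rw [hΨ]
  -- Step 3: `Ψ` reads only the site `c`; on the `L'`-fibre it is `x ↦ TM (T^[n] k_v) x` at `σ_c`
  set g : ℝ × ℝ → ℝ≥0∞ := TM (Tr^[n] fun z => k z v) with hg
  have hTrm : Measurable (Tr^[n] fun z => k z v) := measurable_iterate_transfer hkm hwm hTr hkv n
  have hΨint : Measurable fun σ : ChainConfig =>
      (F σ * ∏ y ∈ W', (w (σ y) * k (σ (y - 1)) (σ y))) * (Tr^[n] fun z => k z v) (σ d) :=
    (hFm.mul (hWB W')).mul (hTrm.comp (measurable_pi_apply d))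
  have hΨdep : DependsOn (∫⋯∫⁻_W', (fun σ : ChainConfig =>
        (F σ * ∏ y ∈ W', (w (σ y) * k (σ (y - 1)) (σ y))) * (Tr^[n] fun z => k z v) (σ d))
      ∂fun _ : ℤ => (volume : Measure (ℝ × ℝ))) ((↑(Finset.Icc c d) : Set ℤ) \ (↑W' : Set ℤ)) := by
    refine dependsOn_lmarginal W' fun σ σ' hσ => ?_
    have h1 := hdepFW hσ
    dsimp only at h1 ⊢
    rw [h1, hσ d (by simp only [Finset.coe_Icc, Set.mem_Icc]; omega)]
  have hΨc : ∀ σ : ChainConfig, (∫⋯∫⁻_W', (fun σ : ChainConfig =>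
        (F σ * ∏ y ∈ W', (w (σ y) * k (σ (y - 1)) (σ y))) * (Tr^[n] fun z => k z v) (σ d))
      ∂fun _ : ℤ => (volume : Measure (ℝ × ℝ))) σ = g (σ c) := by
    intro σ
    rw [hg, hTM]
    refine hΨdep fun i hi => ?_
    have hic : i = c := by
      rcases hi with ⟨hi1, hi2⟩
      simp only [Finset.coe_Icc, Set.mem_Icc, hW'] at hi1 hi2
      omega
    subst hic
    simp
  have hgm : Measurable g := by
    have h1 : g = fun x => (∫⋯∫⁻_W', (fun σ : ChainConfig =>
        (F σ * ∏ y ∈ W', (w (σ y) * k (σ (y - 1)) (σ y))) * (Tr^[n] fun z => k z v) (σ d))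
      ∂fun _ : ℤ => (volume : Measure (ℝ × ℝ))) (Function.update η₀ c x) := by
      funext x; rw [hg, hTM]
    rw [h1]
    exact (hΨint.lmarginal _).comp (measurable_update _)
  simp_rw [hΨc]
  -- Step 4: the block `L'` gives `T^[n+1] g` at the left boundary spin
  have hLico : L' = Finset.Ico (c - n) (c - n + ((n + 1 : ℕ) : ℤ)) := by
    ext x; simp only [hL', Finset.mem_Icc, Finset.mem_Ico]; push_cast; omega
  have hfunL : (fun σ : ChainConfig => (∏ y ∈ L', (w (σ y) * k (σ (y - 1)) (σ y))) * g (σ c)) =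
      fun σ => (∏ y ∈ Finset.Ico (c - n) (c - n + ((n + 1 : ℕ) : ℤ)), (w (σ y) * k (σ (y - 1)) (σ y))) *
        g (σ (c - n + ((n + 1 : ℕ) : ℤ) - 1)) * (fun _ : ChainConfig => (1 : ℝ≥0∞)) σ := by
    funext σ
    rw [hLico, show c - (n : ℤ) + ((n + 1 : ℕ) : ℤ) - 1 = c by push_cast; ring, mul_one]
  rw [hfunL, hLico, lmarginal_Ico_blockWeight_eq_iterate_transfer hkm hwm hTr hgm (n + 1) (c - n)
    measurable_const (fun _ _ _ => rfl) η, mul_one]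

end Transfer

end OscillatorChain

end Literature.MathematicalPhysics.KineticTheory.HeatConduction

end
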